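import Mathlib
import Literature.Analysis.ODE.BarrierTouching
import HarnessLib

/-!
# The touching (weighted maximum-principle) lemma for COMPLEX-valued scalar transport `c y′ = μ y − F`

Topic `Literature/Analysis/ODE` (namespace `Literature.Analysis.ODE`). The complex-valued form of
`barrier_touching` (`Literature.Analysis.ODE.BarrierTouching`): for a real speed `c`, a COMPLEX rate `μ` and a complex
forcing `F`, a differentiable `y : ℝ → ℂ` with `c y′ = μ y − F` at a point `x⋆` where the gauge `‖y‖/yb` is maximal on
`[x₁, x₂]` (`yb > 0` a `C¹` barrier) satisfies, at an interior point or an OUTFLOW endpoint (`x⋆ = x₁ ⇒ c ≥ 0`,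
`x⋆ = x₂ ⇒ c ≤ 0`),

  `(‖y(x⋆)‖/yb(x⋆)) · (Re μ · yb(x⋆) − c · yb′(x⋆)) ≤ ‖F‖`.

Only the REAL PART of the rate enters: the lemma is `barrier_touching` applied to the real function `|y|²`, whose equation
is `c (|y|²)′ = 2 Re μ |y|² − 2 Re(ȳ F)`, followed by Cauchy–Schwarz `|Re(ȳF)| ≤ ‖y‖‖F‖`. This is the comparison step of
sup-norm a-priori estimates for complex (e.g. Laplace-transformed, spectral parameter `Λ = μ + …`) first-order systems
in characteristic form: damping is measured by `Re Λ`, the oscillation `Im Λ` is free.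

## References

* M. H. Protter, H. F. Weinberger, *Maximum Principles in Differential Equations*, Springer 1984, Ch. 1 (the
  one-dimensional maximum principle and its generalised, weighted form `u/w`). Key `ProtterWeinberger1984`.
* P. Hartman, *Ordinary Differential Equations*, 2nd ed., SIAM 2002, Ch. III (differential inequalities). Key
  `Hartman2002`.
-/

noncomputable section

open Set Filter Topology

namespace Literature.Analysis.ODE

/-- Cauchy–Schwarz in `ℂ ≅ ℝ²`: `|Re y · Re F + Im y · Im F| ≤ ‖y‖ ‖F‖`. [folklore] -/
theorem abs_re_inner_le_norm_mul_norm (y F : ℂ) : |y.re * F.re + y.im * F.im| ≤ ‖y‖ * ‖F‖ := by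
  refine abs_le_of_sq_le_sq ?_ (mul_nonneg (norm_nonneg _) (norm_nonneg _))
  rw [mul_pow, Complex.sq_norm, Complex.sq_norm, Complex.normSq_apply, Complex.normSq_apply]
  nlinarith [sq_nonneg (y.re * F.im - y.im * F.re)]

/-- **The touching lemma for complex unknowns.** Let `yb > 0` on `[x₁, x₂]` be differentiable at `x⋆ ∈ [x₁, x₂]`, let
`y : ℝ → ℂ` be differentiable at `x⋆` with `c · y′(x⋆) = μ · y(x⋆) − F` (`c` real, `μ, F` complex), and let `‖y‖/yb` attain
its maximum over `[x₁, x₂]` at `x⋆`. If `x⋆ = x₁ ⇒ c ≥ 0` and `x⋆ = x₂ ⇒ c ≤ 0` (no inflow endpoint), then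
`(‖y(x⋆)‖/yb(x⋆)) · (Re μ · yb(x⋆) − c · yb′(x⋆)) ≤ ‖F‖`. Proof: `barrier_touching` for `|y|²` with barrier `yb²`, whose
equation is `c(|y|²)′ = 2 Re μ |y|² − 2 Re(ȳF)`, then Cauchy–Schwarz and division by `2‖y(x⋆)‖ yb(x⋆)`.
[cite: ProtterWeinberger1984, Ch. 1, Thm 1 and §5] -/
theorem barrier_touching_complex {y : ℝ → ℂ} {y' μ F : ℂ} {c : ℝ} {yb : ℝ → ℝ} {yb' : ℝ} {x₁ x₂ xs : ℝ}
    (hxs : xs ∈ Icc x₁ x₂) (hy : HasDerivAt y y' xs) (hyb : HasDerivAt yb yb' xs)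
    (hpos : ∀ x ∈ Icc x₁ x₂, 0 < yb x) (hmax : IsMaxOn (fun x => ‖y x‖ / yb x) (Icc x₁ x₂) xs)
    (hode : (c : ℂ) * y' = μ * y xs - F) (hleft : xs = x₁ → 0 ≤ c) (hright : xs = x₂ → c ≤ 0) :
    ‖y xs‖ / yb xs * (μ.re * yb xs - c * yb') ≤ ‖F‖ := by
  have hybs : 0 < yb xs := hpos xs hxs
  have hnorm : ∀ z : ℂ, ‖z‖ ^ 2 = z.re * z.re + z.im * z.im := fun z => by
    rw [Complex.sq_norm, Complex.normSq_apply]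
  -- the real function `Q = |y|²` and its equation
  set Q : ℝ → ℝ := fun x => (y x).re * (y x).re + (y x).im * (y x).im with hQ
  have hQeq : ∀ x, Q x = ‖y x‖ ^ 2 := fun x => (hnorm (y x)).symm
  have hre : HasDerivAt (fun x => (y x).re) y'.re xs := by
    simpa [Function.comp_def] using Complex.reCLM.hasFDerivAt.comp_hasDerivAt xs hy
  have him : HasDerivAt (fun x => (y x).im) y'.im xs := by
    simpa [Function.comp_def] using Complex.imCLM.hasFDerivAt.comp_hasDerivAt xs hy
  have hQd : HasDerivAt Q (y'.re * (y xs).re + (y xs).re * y'.re + (y'.im * (y xs).im + (y xs).im * y'.im)) xs :=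
    (hre.mul hre).add (him.mul him)
  have hYd : HasDerivAt (fun x => yb x ^ 2) (2 * yb xs * yb') xs := by
    have h := hyb.mul hyb
    refine (h.congr_of_eventuallyEq (Eventually.of_forall fun x => by simp [sq])).congr_deriv ?_
    ring
  -- real and imaginary parts of the equation
  have e1 := congrArg Complex.re hode
  have e2 := congrArg Complex.im hode
  simp only [Complex.mul_re, Complex.mul_im, Complex.ofReal_re, Complex.ofReal_im, zero_mul, sub_zero, add_zero,
    Complex.sub_re, Complex.sub_im] at e1 e2
  have hodeQ : c * (y'.re * (y xs).re + (y xs).re * y'.re + (y'.im * (y xs).im + (y xs).im * y'.im)) =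
      2 * μ.re * Q xs - 2 * ((y xs).re * F.re + (y xs).im * F.im) := by
    simp only [hQ]
    linear_combination 2 * (y xs).re * e1 + 2 * (y xs).im * e2
  -- the gauge of `Q` with barrier `yb²` is maximal at `x⋆` as well
  have hposY : ∀ x ∈ Icc x₁ x₂, 0 < yb x ^ 2 := fun x hx => pow_pos (hpos x hx) 2
  have hmaxQ : IsMaxOn (fun x => |Q x| / yb x ^ 2) (Icc x₁ x₂) xs := by
    intro x hx
    have h1 : ‖y x‖ / yb x ≤ ‖y xs‖ / yb xs := hmax hx
    have h0 : 0 ≤ ‖y x‖ / yb x := div_nonneg (norm_nonneg _) (hpos x hx).le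
    have h2 := pow_le_pow_left₀ h0 h1 2
    rw [div_pow, div_pow] at h2
    simp only [mem_setOf_eq, hQeq, abs_of_nonneg (sq_nonneg ‖y x‖), abs_of_nonneg (sq_nonneg ‖y xs‖)]
    exact h2
  -- the real touching lemma for `Q`
  have key := barrier_touching (c := fun _ => c) (β := fun _ => 2 * μ.re)
    (h := fun _ => 2 * ((y xs).re * F.re + (y xs).im * F.im)) (y := Q)
    (y' := fun _ => y'.re * (y xs).re + (y xs).re * y'.re + (y'.im * (y xs).im + (y xs).im * y'.im))
    (yb := fun x => yb x ^ 2) (yb' := fun _ => 2 * yb xs * yb') hxs hQd hYd hposY hmaxQ hodeQ hleft hright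
  -- unpack: `θ² · 2 yb (Re μ yb − c yb′) ≤ 2 θ yb ‖F‖`
  have hQs : |Q xs| = ‖y xs‖ ^ 2 := by rw [hQeq, abs_of_nonneg (sq_nonneg _)]
  rw [hQs] at key
  have hCS : |2 * ((y xs).re * F.re + (y xs).im * F.im)| ≤ 2 * (‖y xs‖ * ‖F‖) := by
    rw [abs_mul, abs_of_pos (by norm_num : (0 : ℝ) < 2)]
    exact mul_le_mul_of_nonneg_left (abs_re_inner_le_norm_mul_norm _ _) (by norm_num)
  have key' : ‖y xs‖ ^ 2 / yb xs ^ 2 * (2 * μ.re * yb xs ^ 2 - c * (2 * yb xs * yb')) ≤ 2 * (‖y xs‖ * ‖F‖) :=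
    key.trans hCS
  set θ : ℝ := ‖y xs‖ / yb xs with hθ
  have hθ0 : 0 ≤ θ := div_nonneg (norm_nonneg _) hybs.le
  have hyθ : ‖y xs‖ = θ * yb xs := by rw [hθ, div_mul_cancel₀ _ hybs.ne']
  have hθ2 : ‖y xs‖ ^ 2 / yb xs ^ 2 = θ ^ 2 := by rw [hθ, div_pow]
  rw [hθ2, hyθ] at key'
  -- `key' : θ² (2 Re μ yb² − 2 c yb yb′) ≤ 2 θ yb ‖F‖`
  rcases eq_or_lt_of_le hθ0 with h0 | hθpos
  · rw [← h0, zero_mul]; exact norm_nonneg _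
  · have h2 : 0 < 2 * θ * yb xs := by positivity
    have key'' : 2 * θ * yb xs * (θ * (μ.re * yb xs - c * yb')) ≤ 2 * θ * yb xs * ‖F‖ := by
      have e : 2 * θ * yb xs * (θ * (μ.re * yb xs - c * yb')) =
          θ ^ 2 * (2 * μ.re * yb xs ^ 2 - c * (2 * yb xs * yb')) := by ring
      rw [e]
      calc θ ^ 2 * (2 * μ.re * yb xs ^ 2 - c * (2 * yb xs * yb')) ≤ 2 * (θ * yb xs * ‖F‖) := key'
        _ = 2 * θ * yb xs * ‖F‖ := by ring
    exact le_of_mul_le_mul_left key'' h2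

/-- The same bound with the maximal gauge value `θ` as a separate variable: if `‖y‖ ≤ θ yb` on `[x₁, x₂]` with equality
at an admissible touching point `x⋆`, then `θ (Re μ · yb(x⋆) − c · yb′(x⋆)) ≤ ‖F‖`.
[cite: ProtterWeinberger1984, Ch. 1, Thm 1 and §5] -/
theorem barrier_touching_complex' {y : ℝ → ℂ} {y' μ F : ℂ} {c : ℝ} {yb : ℝ → ℝ} {yb' : ℝ} {x₁ x₂ xs θ : ℝ}
    (hxs : xs ∈ Icc x₁ x₂) (hy : HasDerivAt y y' xs) (hyb : HasDerivAt yb yb' xs)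
    (hpos : ∀ x ∈ Icc x₁ x₂, 0 < yb x) (hle : ∀ x ∈ Icc x₁ x₂, ‖y x‖ ≤ θ * yb x) (heq : ‖y xs‖ = θ * yb xs)
    (hode : (c : ℂ) * y' = μ * y xs - F) (hleft : xs = x₁ → 0 ≤ c) (hright : xs = x₂ → c ≤ 0) :
    θ * (μ.re * yb xs - c * yb') ≤ ‖F‖ := by
  have hybs : 0 < yb xs := hpos xs hxs
  have hθ : ‖y xs‖ / yb xs = θ := by rw [heq, mul_div_assoc, div_self hybs.ne', mul_one]
  have hmax : IsMaxOn (fun x => ‖y x‖ / yb x) (Icc x₁ x₂) xs := by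
    intro x hx
    simp only [mem_setOf_eq, hθ]
    rw [div_le_iff₀ (hpos x hx)]
    exact hle x hx
  have := barrier_touching_complex hxs hy hyb hpos hmax hode hleft hright
  rwa [hθ] at this

end Literature.Analysis.ODE

end
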